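import Summits.NavierStokesRegularity.NavierStokesRegularity.Theorems.PerpetualPumpPumpTransferBandSums
import Summits.NavierStokesRegularity.NavierStokesRegularity.Theorems.PerpetualPumpPumpTransferFibreBounds
import Literature.Analysis.FluidPDE.TaoCascadeMotion
import Mathlib.MeasureTheory.Integral.Lebesgue.DominatedConvergence
import Mathlib.MeasureTheory.Constructions.Polish.Basic
import HarnessLib

/-!
# `PerpetualPump.PumpTransfer` (stmt-NavierStokesRegularity-1837), line `Sketch`, stub `stub_bandField_exists`

Registered stub of the lead's skeleton `Cruxes/PumpTransfer/Lines/Sketch.lean` (lead prover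
prover-line-stmt-NavierStokesRegularity-1837-0). The band-structured field of heat fibres driven by coefficients `X` exists in `C⁰_t H¹⁰_df`.

Vocabulary: Tao's cascade operator (4.1) with wavelet data `𝒟 : CascadeWaveletData ε₀ m`
(`Literature/Analysis/FluidPDE/TaoCascadeOperator.lean`), the heat fibres `duhamelScalar δ Qr L t`,
weights `modeWeight 𝒟 i n = |ψ̂_{i,n}|²` and `modeDelta` (`TaoCascadeDuhamel.lean`), `heatRate ξ = 4π²|ξ|²`
(`TaoBandHeatGroup.lean`), the circuit nonlinearity `TaoCascade.quadTerm` (`TaoCascadeODE.lean`).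

## The argument

The field is synthesised **on the Fourier side**. For `p = (i,n)` let `ψ̂_p = 𝓕 ψ_{i,n}` and let
`φ_p(ξ,t) = duhamelScalar (A·1_{p=(i₀,n₀)}) Q_p (4π²|ξ|²) t` be the scalar heat fibre driven by
`Q_p(s) = quadTerm_{i,n}(X(max(s,0)))`. Put `G_t(ξ) = ∑_p φ_p(ξ,t) ψ̂_p(ξ)` (the band sum of the
statement) and `u(t) = 𝓕⁻¹ G_t ∈ L²` for `t ∈ [0,S)` (`0` elsewhere).

The band-sum algebra is the helper file `PerpetualPumpPumpTransferBandSums.lean`, the scalar bounds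
are `PerpetualPumpPumpTransferFibreBounds.lean` (same namespace, landed as `--supports` helpers).

* *Band structure* (`ae_wavelet_cases`): for a.e. `ξ` at most one `ψ̂_p(ξ)` is nonzero (the
  frequency regions `(1+ε₀)ⁿ(Bᵢ ∪ -Bᵢ)` are pairwise disjoint,
  `CascadeWaveletData.not_mem_freqRegion_of_ne`), so every band sum collapses a.e. to one term;
  this gives measurability of `G_t` (a.e. limit of finite partial sums), the conjugation symmetry
  `\overline{G_t(-ξ)} = G_t(ξ)` (real even fibres, real wavelets) whence `u(t)` is real, and
  `ξ · G_t(ξ) = 0` (divergence-free wavelets).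
* *Weighted bound* (`lintegral_weight_enorm_bandSum_le`): if `|φ_p| ≤ B_p` then
  `∫ (1+|ξ|²)^{10} |G_t|² ≤ ∑_p 5^{10} (1+(1+ε₀)^{10n})² B_p²` (on the region of `p`,
  `|ξ| ≤ 2(1+ε₀)ⁿ`; `∫|ψ̂_p|² = 1`).
* *Fibre bounds* (`abs_quadTerm_le`, `abs_duhamelScalar_le_of_nonneg`): from
  `(1+(1+ε₀)^{10k})|X_{j,k}| ≤ C` on `[0,S']`,
  `|Q_p| ≤ K_α ((1+ε₀)^{2n}+(1+ε₀)^{3n}) (2^{10}C)² / (1+(1+ε₀)^{10n})²` and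
  `|φ_p(ξ,t)| ≤ |A|1_{p=(i₀,n₀)} + S'·sup|Q_p| ≤ M · b_n`, `b_n = ((1+ε₀)^{2n}+(1+ε₀)^{3n})/(1+(1+ε₀)^{10n})²`,
  with `∑_n (1+(1+ε₀)^{10n})² b_n² < ∞` (`summable_decay`): so `u(t) ∈ H¹⁰_df`.
* *Continuity in `H¹⁰`*: `‖u(t')-u(t)‖²_{H¹⁰} ≤ ∫ ∑_p 5^{10}(1+(1+ε₀)^{10n})² (φ_p(ξ,t')-φ_p(ξ,t))² |ψ̂_p(ξ)|² dξ → 0`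
  by dominated convergence (fibres continuous in `t`, dominated by `(2B_p)²` on `[0,S']`, `S' = (t+S)/2`).

## References

* T. Tao, J. Amer. Math. Soc. 29 (2016), 601–674 = arXiv:1402.0290v3, §4 Lemma 4.1 (4.14). [`Tao2016AveragedNS`]
-/

noncomputable section

-- the nested summit namespace is the tree's layout (D-0017)
set_option linter.dupNamespace false

namespace Summit.NavierStokesRegularity.NavierStokesRegularity.Theorems.PerpetualPumpPumpTransfer

open MeasureTheory Set Filter Topology FourierTransform
open scoped ENNReal SchwartzMap ComplexConjugate
open Literature.Analysis Literature.Analysis.FluidPDE Literature.Analysis.FluidPDE.Tao2016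

/-! ### The stub -/

set_option maxHeartbeats 400000 in
/-- **Stub `stub_bandField_exists`.** The band-structured field of heat fibres driven by coefficients `X`
exists in `C⁰_t H¹⁰_df`: given continuous coefficients `X_{i,n}` with the weighted a priori bound
`(1+(1+ε₀)^{10n})|X_{i,n}| ≤ C(S')` on `[0,S']`, `S' < S`, there is `u : [0,S) → H¹⁰_df`, continuous in `H¹⁰`,
with `û(t) = ∑_{(i,n)} φ_{i,n}(ξ,t) ψ̂_{i,n}(ξ)` a.e., `φ_{i,n}(ξ,t) = duhamelScalar (A·1_{(i,n)=(i₀,n₀)}) Q_{i,n} (4π²|ξ|²) t`,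
`Q_{i,n}(s) = quadTerm_{i,n}(X(max(s,0)))` (Lemma 4.1 read mode by mode, converse direction). Proof:
`u(t) = 𝓕⁻¹` of the band sum, which is square integrable with finite weighted integral
(`lintegral_weight_enorm_bandSum_le` with the fibre bounds `abs_quadTerm_le`,
`abs_duhamelScalar_le_of_nonneg`, `summable_decay`), real (`ae_conj3_bandSum_neg`) and divergence
free (`ae_cdot_bandSum_eq_zero`); `H¹⁰`-continuity by dominated convergence on the Fourier side
(see the module docstring). [cite: Tao2016AveragedNS, §4 Lemma 4.1 (4.14)] -/
theorem stub_bandField_exists :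
    ∀ (ε₀ : ℝ), 0 < ε₀ → ε₀ < 1 → ∀ (m : ℕ) (𝒟 : CascadeWaveletData ε₀ m)
    (α : Fin m → Fin m → Fin m → ℤ × ℤ × ℤ → ℝ) (i₀ : Fin m) (n₀ : ℤ) (A S : ℝ)
    (X : Fin m → ℤ → ℝ → ℝ),
    (∀ (i : Fin m) (n : ℤ), Continuous (X i n)) →
    (∀ S' ∈ Ico (0 : ℝ) S, ∃ C : ℝ, ∀ (i : Fin m) (n : ℤ), ∀ t ∈ Icc (0 : ℝ) S',
      (1 + ((1 + ε₀) ^ n) ^ 10) * |X i n t| ≤ C) →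
    ∃ u : ℝ → L2C,
      (∀ t ∈ Ico (0 : ℝ) S, MemH10df (u t)) ∧ ContinuousInH10On (Ico (0 : ℝ) S) u ∧
      ∀ t ∈ Ico (0 : ℝ) S, fourierFn (u t) =ᵐ[volume] fun ξ => ∑' p : Fin m × ℤ,
        ((duhamelScalar (A * modeDelta i₀ p.1 n₀ p.2)
            (fun s => TaoCascade.quadTerm ε₀ α X p.1 p.2 (max s 0)) (heatRate ξ) t : ℝ) : ℂ) •
          fourierFn (cascadeWavelet ε₀ (𝒟.ψ p.1) p.2) ξ := by
  intro ε₀ hε₀ hε₁ m 𝒟 α i₀ n₀ A S X hXc hapr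
  have hε' : 0 < 1 + ε₀ := by linarith
  have hε₂ : ε₀ ≤ 2 := by linarith
  -- the fibres `φ_p(ξ,t)` and the band sums `G_t(ξ)`
  set φ : Fin m × ℤ → EuclideanSpace ℝ (Fin 3) → ℝ → ℝ := fun p ξ t =>
    duhamelScalar (A * modeDelta i₀ p.1 n₀ p.2) (fun s => TaoCascade.quadTerm ε₀ α X p.1 p.2 (max s 0))
      (heatRate ξ) t with hφ
  set G : ℝ → EuclideanSpace ℝ (Fin 3) → EuclideanSpace ℂ (Fin 3) := fun t ξ =>
    ∑' p : Fin m × ℤ, ((φ p ξ t : ℝ) : ℂ) • fourierFn (cascadeWavelet ε₀ (𝒟.ψ p.1) p.2) ξ with hG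
  -- continuity of the forcings and of the fibres
  have hQc : ∀ p : Fin m × ℤ, Continuous fun s : ℝ => TaoCascade.quadTerm ε₀ α X p.1 p.2 (max s 0) := by
    intro p
    have hmax : Continuous fun s : ℝ => max s 0 := continuous_id.max continuous_const
    unfold TaoCascade.quadTerm
    refine continuous_finsetSum _ fun i₁ _ => continuous_finsetSum _ fun i₂ _ =>
      continuous_finsetSum _ fun μ _ => ?_
    exact continuous_const.mul (((hXc _ _).comp hmax).mul ((hXc _ _).comp hmax))
  have hφt : ∀ (p : Fin m × ℤ) (ξ : EuclideanSpace ℝ (Fin 3)), Continuous fun t => φ p ξ t := by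
    intro p ξ
    exact (continuous_duhamelScalar₂ (δ := A * modeDelta i₀ p.1 n₀ p.2) (hQc p)).comp
      (continuous_const.prodMk continuous_id : Continuous fun t : ℝ => (heatRate ξ, t))
  have hφξ : ∀ (p : Fin m × ℤ) (t : ℝ), Continuous fun ξ : EuclideanSpace ℝ (Fin 3) => φ p ξ t := by
    intro p t
    exact (continuous_duhamelScalar₂ (δ := A * modeDelta i₀ p.1 n₀ p.2) (hQc p)).comp
      (continuous_heatRate.prodMk continuous_const : Continuous fun ξ : EuclideanSpace ℝ (Fin 3) => (heatRate ξ, t))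
  have hφneg : ∀ (p : Fin m × ℤ) (ξ : EuclideanSpace ℝ (Fin 3)) (t : ℝ), φ p (-ξ) t = φ p ξ t := by
    intro p ξ t
    simp only [hφ, heatRate_neg]
  -- uniform fibre bounds on compact sub-intervals `[0,S'] ⊂ [0,S)`, summable against the band weights
  have hbound : ∀ S' ∈ Ico (0 : ℝ) S, ∃ B : Fin m × ℤ → ℝ,
      (∀ (p : Fin m × ℤ) (ξ : EuclideanSpace ℝ (Fin 3)), ∀ τ ∈ Icc (0 : ℝ) S', |φ p ξ τ| ≤ B p) ∧
      Summable (fun p : Fin m × ℤ => 5 ^ 10 * (1 + ((1 + ε₀) ^ p.2) ^ 10) ^ 2 * B p ^ 2) := by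
    intro S' hS'
    obtain ⟨C, hC⟩ := hapr S' hS'
    set Kα : ℝ := ∑ i₃ : Fin m, ∑ i₁ : Fin m, ∑ i₂ : Fin m, ∑ μ ∈ TaoCascade.shiftSet, |α i₁ i₂ i₃ μ|
      with hKα
    have hKα0 : 0 ≤ Kα := by rw [hKα]; positivity
    set b : ℤ → ℝ := fun n => (((1 + ε₀) ^ n) ^ 2 + ((1 + ε₀) ^ n) ^ 3) / (1 + ((1 + ε₀) ^ n) ^ 10) ^ 2
      with hb
    have hb0 : ∀ n, 0 < b n := fun n => by
      have h := zpow_pos hε' n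
      rw [hb]
      positivity
    -- the forcing for `s ≤ S'`
    have hQb : ∀ (p : Fin m × ℤ) (s : ℝ), s ≤ S' →
        |TaoCascade.quadTerm ε₀ α X p.1 p.2 (max s 0)| ≤ Kα * (2 ^ 10 * C) ^ 2 * b p.2 := by
      intro p s hs
      have h := abs_quadTerm_le hε₀ hε₁ α X
        (fun j k => hC j k (max s 0) ⟨le_max_right _ _, max_le hs hS'.1⟩) p.1 p.2
      refine h.trans (le_of_eq ?_)
      simp only [hKα, hb, div_pow]
      ring
    have hKb0 : ∀ n, 0 ≤ Kα * (2 ^ 10 * C) ^ 2 * b n := fun n =>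
      mul_nonneg (mul_nonneg hKα0 (sq_nonneg _)) (hb0 n).le
    set M : ℝ := |A| / b n₀ + S' * (Kα * (2 ^ 10 * C) ^ 2) with hM
    refine ⟨fun p => M * b p.2, fun p ξ τ hτ => ?_, ?_⟩
    · -- `|φ_p(ξ,τ)| ≤ |A| 1_{p=(i₀,n₀)} + τ sup|Q_p| ≤ M b_n`
      have h1 : |φ p ξ τ| ≤ |A * modeDelta i₀ p.1 n₀ p.2| + τ * (Kα * (2 ^ 10 * C) ^ 2 * b p.2) :=
        abs_duhamelScalar_le_of_nonneg (heatRate_nonneg ξ) hτ.1 fun s hs => hQb p s (hs.2.trans hτ.2)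
      have h2 : |A * modeDelta i₀ p.1 n₀ p.2| ≤ |A| / b n₀ * b p.2 := by
        unfold modeDelta
        split_ifs with h
        · rw [mul_one, ← h.2, div_mul_cancel₀ _ (hb0 n₀).ne']
        · rw [mul_zero, abs_zero]
          exact mul_nonneg (div_nonneg (abs_nonneg _) (hb0 n₀).le) (hb0 _).le
      have h3 : τ * (Kα * (2 ^ 10 * C) ^ 2 * b p.2) ≤ S' * (Kα * (2 ^ 10 * C) ^ 2) * b p.2 := by
        calc τ * (Kα * (2 ^ 10 * C) ^ 2 * b p.2) ≤ S' * (Kα * (2 ^ 10 * C) ^ 2 * b p.2) :=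
              mul_le_mul_of_nonneg_right hτ.2 (hKb0 _)
          _ = S' * (Kα * (2 ^ 10 * C) ^ 2) * b p.2 := by ring
      calc |φ p ξ τ| ≤ |A| / b n₀ * b p.2 + S' * (Kα * (2 ^ 10 * C) ^ 2) * b p.2 :=
            h1.trans (add_le_add h2 h3)
        _ = M * b p.2 := by rw [hM]; ring
    · -- summability over the modes
      have hg := summable_decay (a := 1 + ε₀) (by linarith)
      have hprod : Summable fun p : Fin m × ℤ => (1 : ℝ) * (5 ^ 10 * M ^ 2 *
          ((((1 + ε₀) ^ p.2) ^ 2 + ((1 + ε₀) ^ p.2) ^ 3) ^ 2 / (1 + ((1 + ε₀) ^ p.2) ^ 10) ^ 2)) :=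
        (Summable.of_finite (L := .unconditional _) (f := fun _ : Fin m => (1 : ℝ))).mul_of_nonneg
          (hg.mul_left (5 ^ 10 * M ^ 2)) (fun _ => zero_le_one) (fun n => by positivity)
      refine hprod.congr fun p => ?_
      have hc := zpow_pos hε' p.2
      simp only [hb]
      field_simp
  -- measurability and finiteness of the weighted integral of `G_t`, `t ∈ [0,S)`
  have hGmeas : ∀ t, AEStronglyMeasurable (G t) volume := fun t =>
    aestronglyMeasurable_bandSum hε₀ 𝒟 (c := fun p ξ => φ p ξ t) fun p => (hφξ p t).measurable
  have hGfin : ∀ t ∈ Ico (0 : ℝ) S, sobolevWeightIntegral 10 (G t) < ∞ := by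
    intro t ht
    obtain ⟨B, hB, hsum⟩ := hbound t ht
    have h := lintegral_weight_enorm_bandSum_le hε₀ hε₂ 𝒟 (fun p ξ => φ p ξ t) B
      fun p ξ => hB p ξ t ⟨ht.1, le_rfl⟩
    calc sobolevWeightIntegral 10 (G t)
        ≤ ∑' p : Fin m × ℤ, ENNReal.ofReal (5 ^ 10 * (1 + ((1 + ε₀) ^ p.2) ^ 10) ^ 2 * B p ^ 2) := h
      _ = ENNReal.ofReal (∑' p : Fin m × ℤ, 5 ^ 10 * (1 + ((1 + ε₀) ^ p.2) ^ 10) ^ 2 * B p ^ 2) :=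
          (ENNReal.ofReal_tsum_of_nonneg (fun p => by positivity) hsum).symm
      _ < ∞ := ENNReal.ofReal_lt_top
  have hGmem : ∀ t ∈ Ico (0 : ℝ) S, MemLp (G t) 2 volume := fun t ht =>
    memLp_two_of_sobolevWeightIntegral_lt_top (hGmeas t) (hGfin t ht)
  -- the field `u(t) = 𝓕⁻¹ G_t`
  set u : ℝ → L2C := fun t => if h : t ∈ Ico (0 : ℝ) S then (𝓕⁻ ((hGmem t h).toLp (G t)) : L2C) else 0
    with hu
  have hfour : ∀ t ∈ Ico (0 : ℝ) S, fourierFn (u t) =ᵐ[volume] G t := by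
    intro t ht
    simp only [hu, dif_pos ht]
    exact fourierFn_fourierInv_toLp _
  refine ⟨u, fun t ht => ⟨?_, ?_, ?_⟩, fun t ht => ?_, fun t ht => hfour t ht⟩
  · -- finite `H¹⁰` norm
    rw [eFourierSobolevNorm_lt_top_iff, sobolevWeightIntegral_congr_ae (hfour t ht)]
    exact hGfin t ht
  · -- real
    refine isReal_of_fourierFn_conj_symm ?_
    have hq : Measure.QuasiMeasurePreserving (fun x : EuclideanSpace ℝ (Fin 3) => -x) volume volume :=
      (Measure.measurePreserving_neg (volume : Measure (EuclideanSpace ℝ (Fin 3)))).quasiMeasurePreserving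
    filter_upwards [hfour t ht, hq.ae_eq (hfour t ht),
      ae_conj3_bandSum_neg hε₀ 𝒟 (fun p ξ => φ p ξ t) (fun p ξ => hφneg p ξ t)] with ξ h1 h2 h3
    have h2' : fourierFn (u t) (-ξ) = G t (-ξ) := h2
    rw [h1, h2']
    exact h3
  · -- divergence free
    show ∀ᵐ ξ ∂volume, cdot (FunctionSpaces.EuclideanSpace.complexify ξ) (fourierFn (u t) ξ) = 0
    filter_upwards [hfour t ht, ae_cdot_bandSum_eq_zero hε₀ 𝒟 (fun p ξ => φ p ξ t)] with ξ h1 h2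
    rw [h1]
    exact h2
  · -- `H¹⁰`-continuity at `t ∈ [0,S)`: dominated convergence on the Fourier side
    set S' : ℝ := (t + S) / 2 with hS'def
    have hS' : S' ∈ Ico (0 : ℝ) S := ⟨by rw [hS'def]; linarith [ht.1, ht.2], by rw [hS'def]; linarith [ht.2]⟩
    have htS' : t < S' := by rw [hS'def]; linarith [ht.2]
    obtain ⟨B, hB, hsum⟩ := hbound S' hS'
    set w : Fin m × ℤ → ℝ := fun p => 5 ^ 10 * (1 + ((1 + ε₀) ^ p.2) ^ 10) ^ 2 with hw
    have hw0 : ∀ p, 0 ≤ w p := fun p => by rw [hw]; positivity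
    set F : ℝ → EuclideanSpace ℝ (Fin 3) → ℝ≥0∞ := fun t' ξ => ∑' p : Fin m × ℤ,
      ENNReal.ofReal (w p * (φ p ξ t' - φ p ξ t) ^ 2) *
        ‖fourierFn (cascadeWavelet ε₀ (𝒟.ψ p.1) p.2) ξ‖ₑ ^ 2 with hF
    set bound : EuclideanSpace ℝ (Fin 3) → ℝ≥0∞ := fun ξ => ∑' p : Fin m × ℤ,
      ENNReal.ofReal (w p * (2 * B p) ^ 2) * ‖fourierFn (cascadeWavelet ε₀ (𝒟.ψ p.1) p.2) ξ‖ₑ ^ 2 with hbd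
    have hΨm : ∀ p : Fin m × ℤ, Measurable fun ξ : EuclideanSpace ℝ (Fin 3) =>
        ‖fourierFn (cascadeWavelet ε₀ (𝒟.ψ p.1) p.2) ξ‖ₑ ^ 2 := fun p =>
      (Lp.stronglyMeasurable _).measurable.enorm.pow_const 2
    -- eventually `t' ∈ [0, S']`
    have hev : ∀ᶠ t' in 𝓝[Ico (0 : ℝ) S] t, t' ∈ Ico (0 : ℝ) S ∧ t' ≤ S' := by
      filter_upwards [self_mem_nhdsWithin, mem_nhdsWithin_of_mem_nhds (Iic_mem_nhds htS')] with t' h1 h2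
      exact ⟨h1, h2⟩
    -- (i) the `H¹⁰` distance is controlled by `∫ F t'`
    have hle : ∀ᶠ t' in 𝓝[Ico (0 : ℝ) S] t,
        FunctionSpaces.eFourierSobolevNorm 10 (u t' - u t) ≤ (∫⁻ ξ, F t' ξ ∂volume) ^ (1 / 2 : ℝ) := by
      filter_upwards [hev] with t' ht'
      have hsub : fourierFn (u t' - u t) =ᵐ[volume] fun ξ =>
          ∑' p : Fin m × ℤ, ((φ p ξ t' - φ p ξ t : ℝ) : ℂ) • fourierFn (cascadeWavelet ε₀ (𝒟.ψ p.1) p.2) ξ := by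
        filter_upwards [fourierFn_sub (u t') (u t), hfour t' ht'.1, hfour t ht,
          ae_bandSum_sub hε₀ 𝒟 (fun p ξ => φ p ξ t') (fun p ξ => φ p ξ t)] with ξ h1 h2 h3 h4
        rw [h1, h2, h3]
        exact h4
      rw [eFourierSobolevNorm_eq, sobolevWeightIntegral_congr_ae hsub]
      refine ENNReal.rpow_le_rpow (lintegral_mono_ae ?_) (by norm_num)
      filter_upwards [ae_weight_enorm_bandSum_le hε₀ hε₂ 𝒟 (fun p ξ => φ p ξ t' - φ p ξ t)] with ξ hξ
      exact hξ
    -- (ii) `∫ F t' → 0` by dominated convergence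
    have hFmeas : ∀ t', Measurable (F t') := fun t' =>
      Measurable.tsum fun p =>
        (ENNReal.measurable_ofReal.comp
          ((continuous_const.mul (((hφξ p t').sub (hφξ p t)).pow 2)).measurable)).mul (hΨm p)
    have hFle : ∀ᶠ t' in 𝓝[Ico (0 : ℝ) S] t,
        ∀ᵐ ξ ∂(volume : Measure (EuclideanSpace ℝ (Fin 3))), F t' ξ ≤ bound ξ := by
      filter_upwards [hev] with t' ht'
      refine Eventually.of_forall fun ξ => ENNReal.tsum_le_tsum fun p => ?_
      refine mul_le_mul' (ENNReal.ofReal_le_ofReal (mul_le_mul_of_nonneg_left ?_ (hw0 p))) le_rfl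
      have h1 := hB p ξ t' ⟨ht'.1.1, ht'.2⟩
      have h2 := hB p ξ t ⟨ht.1, htS'.le⟩
      have h3 : |φ p ξ t' - φ p ξ t| ≤ 2 * B p := (abs_sub _ _).trans (by linarith)
      have h4 := pow_le_pow_left₀ (abs_nonneg _) h3 2
      rwa [sq_abs] at h4
    have hbound_fin : ∫⁻ ξ, bound ξ ∂(volume : Measure (EuclideanSpace ℝ (Fin 3))) ≠ ∞ := by
      have hsum4 : Summable fun p : Fin m × ℤ => w p * (2 * B p) ^ 2 := by
        refine (hsum.mul_left 4).congr fun p => ?_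
        simp only [hw]
        ring
      have h1 : ∫⁻ ξ, bound ξ ∂volume = ∑' p : Fin m × ℤ, ENNReal.ofReal (w p * (2 * B p) ^ 2) := by
        simp only [hbd]
        rw [lintegral_tsum fun p => ((hΨm p).const_mul _).aemeasurable]
        refine tsum_congr fun p => ?_
        rw [lintegral_const_mul _ (hΨm p), lintegral_enorm_sq_fourierFn_cascadeWavelet hε' 𝒟 p.1 p.2, mul_one]
      rw [h1, ← ENNReal.ofReal_tsum_of_nonneg (fun p => mul_nonneg (hw0 p) (sq_nonneg _)) hsum4]
      exact ENNReal.ofReal_ne_top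
    have hlim : ∀ᵐ ξ ∂(volume : Measure (EuclideanSpace ℝ (Fin 3))),
        Tendsto (fun t' => F t' ξ) (𝓝[Ico (0 : ℝ) S] t) (𝓝 0) := by
      filter_upwards [ae_wavelet_cases hε₀ 𝒟] with ξ hξ
      rcases hξ with hall | ⟨p₀, -, hoth⟩
      · have h0 : ∀ t', F t' ξ = 0 := fun t' => by simp [hF, hall]
        simp only [h0]
        exact tendsto_const_nhds
      · have h0 : ∀ t', F t' ξ = ENNReal.ofReal (w p₀ * (φ p₀ ξ t' - φ p₀ ξ t) ^ 2) *
            ‖fourierFn (cascadeWavelet ε₀ (𝒟.ψ p₀.1) p₀.2) ξ‖ₑ ^ 2 := fun t' => by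
          simp only [hF]
          exact tsum_eq_single p₀ fun p hp => by rw [hoth p hp, enorm_zero, zero_pow two_ne_zero, mul_zero]
        simp only [h0]
        have hc : Tendsto (fun t' => w p₀ * (φ p₀ ξ t' - φ p₀ ξ t) ^ 2) (𝓝 t) (𝓝 0) := by
          have hcont : Continuous fun t' => w p₀ * (φ p₀ ξ t' - φ p₀ ξ t) ^ 2 :=
            continuous_const.mul (((hφt p₀ ξ).sub continuous_const).pow 2)
          have h := hcont.tendsto t
          simpa using h
        have h1 : Tendsto (fun t' => ENNReal.ofReal (w p₀ * (φ p₀ ξ t' - φ p₀ ξ t) ^ 2)) (𝓝 t) (𝓝 0) := by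
          rw [← ENNReal.ofReal_zero]
          exact ENNReal.tendsto_ofReal hc
        have h2 := ENNReal.Tendsto.mul_const (b := ‖fourierFn (cascadeWavelet ε₀ (𝒟.ψ p₀.1) p₀.2) ξ‖ₑ ^ 2) h1
          (Or.inr (ENNReal.pow_ne_top enorm_ne_top))
        rw [zero_mul] at h2
        exact h2.mono_left nhdsWithin_le_nhds
    have hF0 : Tendsto (fun t' => ∫⁻ ξ, F t' ξ ∂volume) (𝓝[Ico (0 : ℝ) S] t) (𝓝 0) := by
      have h := tendsto_lintegral_filter_of_dominated_convergence bound
        (Eventually.of_forall hFmeas) hFle hbound_fin hlim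
      simpa using h
    have hF0' : Tendsto (fun t' => (∫⁻ ξ, F t' ξ ∂volume) ^ (1 / 2 : ℝ)) (𝓝[Ico (0 : ℝ) S] t) (𝓝 0) := by
      have h := ((ENNReal.continuous_rpow_const (y := 1 / 2)).tendsto 0).comp hF0
      rwa [ENNReal.zero_rpow_of_pos (by norm_num)] at h
    exact tendsto_of_tendsto_of_tendsto_of_le_of_le' tendsto_const_nhds hF0'
      (Eventually.of_forall fun _ => zero_le) hle

end Summit.NavierStokesRegularity.NavierStokesRegularity.Theorems.PerpetualPumpPumpTransfer

end
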